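import Literature.Computability.AlgebraicComplexity.RankMethodBarriers
import Mathlib.Algebra.Order.BigOperators.Group.Finset
import HarnessLib

/-!
# EGOW 2018 §1.1 — sub-additive measures, the lower bound `c_S(f) ≥ μ(f)/μ(S)`, and barrier
constants `c(Δ)` for a class of measures
(cell val-lit, typer t22, DAG row EGOW2018-B; source `paper:arxiv-1710.09502`;
bib `EfremenkoGargOliveiraWigderson2018`)

K. Efremenko, A. Garg, R. Oliveira, A. Wigderson, *Barriers for rank methods in arithmetic
complexity*, ITCS 2018 = arXiv:1710.09502, §1.1 "Sub-Additive Measures, Rank Bounds and Barriers"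
(pp. 3–5; locators `pNNNN.txt:Lnn` are the chunks of `lit read arxiv:1710.09502`). HONEST FRAMING:
the general (elementary) framework of the paper, typed and proved; `VP ≠ VNP` is NOT proved and
nothing here is progress on it.

The tree's `RankMethodBarriers.lean` types §1.1 for the class `Δ₀^S` of RANK METHODS
(`sComplexity` = `c_S`, `rankMeasure` = `μ_L`, `RankMethodCeiling` = "`c(Δ₀^S) ≤ c`"). This file adds
the enclosing layer the paper states first, for an ARBITRARY class `Δ ⊆ Δ_S` of sub-additive measures:

* "A sub-additive measure `μ` is a function `μ : Ŝ → ℝ⁺` such that `μ(g + h) ≤ μ(g) + μ(h)`"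
  (p0004:L33–35): `IsSubadditiveMeasure μ` — for any ordered additive codomain (`ℕ` for ranks and
  dimensions, `ℝ` as printed).
* "we can immediately derive a lower bound on `c_S(f)` … `c_S(f) ≥ μ(f)/μ(S)`" (p0004:L36–39), with
  `μ(T) = max{μ(g) : g ∈ T}` read as "any bound `r ≥ μ` on `S`": `IsSubadditiveMeasure.apply_le_nsmul`
  (`μ(f) ≤ s • r` for `f = g₁ + ⋯ + g_s`), `IsSubadditiveMeasure.apply_le_sComplexity_nsmul`
  (`μ(f) ≤ c_S(f) • r`) and the quotient form `IsSubadditiveMeasure.div_le_sComplexity` for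
  `ℕ`-valued measures — all PROVED.
* "`Δ_S` denote all possible sub-additive measures on `Ŝ`. It is a triviality that `c_S` itself is a
  sub-additive measure in `Δ_S`" (p0004:L41–42): `sComplexity_add_le` /
  `isSubadditiveMeasure_sComplexity` (PROVED, on a space in which every element decomposes over `S`,
  which is the paper's `Ŝ`).
* "The quantity `c(Δ) = μ(Ŝ)/μ(S)` upper bounds the best lower bound which can be proven using any
  `μ ∈ Δ` … `μ(f) ≤ c(Δ) · μ(S)` for all of them" (p0004:L52–56): `MeasureCeiling Δ S T c`, the
  generalisation of the tree's `RankMethodCeiling` to an arbitrary class `Δ`;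
  `measureCeiling_rankMethods_iff` identifies the two for `Δ = Δ₀^S = rankMethods F V` ("We call the
  elements of `Δ₀^S` as rank methods", p0005:L4), `rankMethods_subset_subadditive` is "Clearly, all these
  `μ_L ∈ Δ₀^S` are sub-additive measures" (p0005:L3), and `sComplexity_le_of_measureCeiling_subadditive`
  is the remark that the full class `Δ_S` admits no ceiling below the true complexity ("this method can
  in principle provide tight lower bound", p0004:L42–43).

## References

* [EfremenkoGargOliveiraWigderson2018] K. Efremenko, A. Garg, R. Oliveira, A. Wigderson,
  *Barriers for rank methods in arithmetic complexity*, ITCS 2018, LIPIcs 94, 1:1–1:19;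
  arXiv:1710.09502, §1.1 (pp. 3–5).
-/

noncomputable section

namespace Literature.Computability.AlgebraicComplexity

/-! ## Sub-additive measures and the lower bound `c_S(f) ≥ μ(f)/μ(S)` -/

section Subadditive

variable {V : Type*} [AddCommMonoid V] {N : Type*} [AddCommMonoid N] [Preorder N]
  [IsOrderedAddMonoid N]

/-- **EGOW 2018, §1.1: sub-additive measure.** "A sub-additive measure `μ` is a function `μ : Ŝ → ℝ⁺`
such that `μ(g + h) ≤ μ(g) + μ(h)` for any `g, h ∈ Ŝ`." We allow any ordered additive codomain `N`
(`ℕ` for the rank and dimension measures of the paper, `ℝ` as printed). [cite: EfremenkoGargOliveiraWigderson2018, §1.1, p. 4] locator: paper:arxiv-1710.09502 p0004.txt:L33 -/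
def IsSubadditiveMeasure (μ : V → N) : Prop :=
  ∀ g h : V, μ (g + h) ≤ μ g + μ h

/-- A sub-additive measure is sub-additive over non-empty finite sums. [cite: EfremenkoGargOliveiraWigderson2018, §1.1, p. 4] locator: paper:arxiv-1710.09502 p0004.txt:L33 -/
theorem IsSubadditiveMeasure.apply_sum_le {μ : V → N} (hμ : IsSubadditiveMeasure μ) {ι : Type*}
    {s : Finset ι} (hs : s.Nonempty) (g : ι → V) : μ (∑ i ∈ s, g i) ≤ ∑ i ∈ s, μ (g i) :=
  Finset.le_sum_nonempty_of_subadditive μ hμ hs g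

/-- The same over all finite sums when `μ(0) ≤ 0` (every measure of the paper has `μ(0) = 0`).
[cite: EfremenkoGargOliveiraWigderson2018, §1.1, p. 4] locator: paper:arxiv-1710.09502 p0004.txt:L33 -/
theorem IsSubadditiveMeasure.apply_sum_le_of_map_zero {μ : V → N} (hμ : IsSubadditiveMeasure μ)
    (h0 : μ 0 ≤ 0) {ι : Type*} (s : Finset ι) (g : ι → V) :
    μ (∑ i ∈ s, g i) ≤ ∑ i ∈ s, μ (g i) :=
  Finset.le_sum_of_subadditive μ h0 hμ s g

/-- **The lower bound, multiplicative form:** if `μ ≤ r` on the simple set `S` and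
`f = g₁ + ⋯ + g_s` with `gᵢ ∈ S`, `s ≥ 1`, then `μ(f) ≤ s • r` ("if we could find any sub-additive
measure `μ` … which is small on all possible `gᵢ` but is large on `f`, we would have a lower bound on
… `s`", p. 3). [cite: EfremenkoGargOliveiraWigderson2018, §1.1, p. 4] locator: paper:arxiv-1710.09502 p0004.txt:L36 -/
theorem IsSubadditiveMeasure.apply_le_nsmul {μ : V → N} (hμ : IsSubadditiveMeasure μ) {S : Set V}
    {r : N} (hr : ∀ g ∈ S, μ g ≤ r) {s : ℕ} (hs : 0 < s) (g : Fin s → V) (hg : ∀ i, g i ∈ S)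
    {f : V} (hf : ∑ i, g i = f) : μ f ≤ s • r := by
  haveI : Nonempty (Fin s) := ⟨⟨0, hs⟩⟩
  rw [← hf]
  calc μ (∑ i, g i) ≤ ∑ i, μ (g i) := hμ.apply_sum_le Finset.univ_nonempty g
    _ ≤ ∑ _i : Fin s, r := Finset.sum_le_sum fun i _ => hr _ (hg i)
    _ = s • r := by simp

/-- The lower bound for all `s` when `μ(0) ≤ 0`. [cite: EfremenkoGargOliveiraWigderson2018, §1.1, p. 4] locator: paper:arxiv-1710.09502 p0004.txt:L36 -/
theorem IsSubadditiveMeasure.apply_le_nsmul_of_map_zero {μ : V → N} (hμ : IsSubadditiveMeasure μ)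
    (h0 : μ 0 ≤ 0) {S : Set V} {r : N} (hr : ∀ g ∈ S, μ g ≤ r) {s : ℕ} (g : Fin s → V)
    (hg : ∀ i, g i ∈ S) {f : V} (hf : ∑ i, g i = f) : μ f ≤ s • r := by
  rw [← hf]
  calc μ (∑ i, g i) ≤ ∑ i, μ (g i) := hμ.apply_sum_le_of_map_zero h0 Finset.univ g
    _ ≤ ∑ _i : Fin s, r := Finset.sum_le_sum fun i _ => hr _ (hg i)
    _ = s • r := by simp

/-- **EGOW 2018, §1.1: `c_S(f) ≥ μ(f)/μ(S)`**, as `μ(f) ≤ c_S(f) • r` for any bound `r` of `μ` on `S`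
(tree `sComplexity` = `c_S`; `μ(0) ≤ 0`; `f` a finite sum of simple elements, as every `f ∈ Ŝ` is).
[cite: EfremenkoGargOliveiraWigderson2018, §1.1, p. 4] locator: paper:arxiv-1710.09502 p0004.txt:L39 -/
theorem IsSubadditiveMeasure.apply_le_sComplexity_nsmul {μ : V → N} (hμ : IsSubadditiveMeasure μ)
    (h0 : μ 0 ≤ 0) {S : Set V} {r : N} (hr : ∀ g ∈ S, μ g ≤ r) {f : V}
    (hf : ∃ s : ℕ, ∃ g : Fin s → V, (∀ i, g i ∈ S) ∧ ∑ i, g i = f) :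
    μ f ≤ sComplexity S f • r := by
  obtain ⟨g, hg, hgf⟩ := sComplexity_spec hf
  exact hμ.apply_le_nsmul_of_map_zero h0 hr g hg hgf

/-- **`c_S(f) ≥ μ(f)/μ(S)` literally**, for `ℕ`-valued measures (natural-number division; `r` any
bound of `μ` on `S`). [cite: EfremenkoGargOliveiraWigderson2018, §1.1, p. 4] locator: paper:arxiv-1710.09502 p0004.txt:L39 -/
theorem IsSubadditiveMeasure.div_le_sComplexity {μ : V → ℕ} (hμ : IsSubadditiveMeasure μ)
    (h0 : μ 0 = 0) {S : Set V} {r : ℕ} (hr : ∀ g ∈ S, μ g ≤ r) {f : V}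
    (hf : ∃ s : ℕ, ∃ g : Fin s → V, (∀ i, g i ∈ S) ∧ ∑ i, g i = f) :
    μ f / r ≤ sComplexity S f := by
  refine Nat.div_le_of_le_mul ?_
  have h := hμ.apply_le_sComplexity_nsmul h0.le hr hf
  rwa [smul_eq_mul, Nat.mul_comm] at h

/-- **"`c_S` itself is a sub-additive measure"** (p. 4), on elements that decompose over `S`:
`c_S(f + g) ≤ c_S(f) + c_S(g)` (concatenate optimal decompositions). [cite: EfremenkoGargOliveiraWigderson2018, §1.1, p. 4] locator: paper:arxiv-1710.09502 p0004.txt:L41 -/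
theorem sComplexity_add_le {S : Set V} {f g : V}
    (hf : ∃ s : ℕ, ∃ a : Fin s → V, (∀ i, a i ∈ S) ∧ ∑ i, a i = f)
    (hg : ∃ s : ℕ, ∃ a : Fin s → V, (∀ i, a i ∈ S) ∧ ∑ i, a i = g) :
    sComplexity S (f + g) ≤ sComplexity S f + sComplexity S g := by
  obtain ⟨a, ha, haf⟩ := sComplexity_spec hf
  obtain ⟨b, hb, hbg⟩ := sComplexity_spec hg
  refine sComplexity_le_of_eq_sum (Fin.append a b) (fun i => ?_) ?_
  · refine Fin.addCases (fun j => ?_) (fun j => ?_) i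
    · rw [Fin.append_left]; exact ha j
    · rw [Fin.append_right]; exact hb j
  · rw [Fin.sum_univ_add]
    simp only [Fin.append_left, Fin.append_right]
    rw [haf, hbg]

/-- **EGOW 2018, §1.1: `c_S ∈ Δ_S`** — on a space `Ŝ` in which every element is a finite sum of simple
ones (the paper's `Ŝ = span(S)`), the `S`-complexity is a sub-additive measure. [cite: EfremenkoGargOliveiraWigderson2018, §1.1, p. 4] locator: paper:arxiv-1710.09502 p0004.txt:L41 -/
theorem isSubadditiveMeasure_sComplexity {S : Set V}
    (hS : ∀ f : V, ∃ s : ℕ, ∃ a : Fin s → V, (∀ i, a i ∈ S) ∧ ∑ i, a i = f) :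
    IsSubadditiveMeasure (sComplexity S) :=
  fun f g => sComplexity_add_le (hS f) (hS g)

/-- Simple elements have `c_S ≤ 1` (so `μ(S) = 1` for `μ = c_S`, and `c_S(f)/c_S(S)` is the trivially
tight bound of p. 4). [cite: EfremenkoGargOliveiraWigderson2018, §1.1, p. 4] locator: paper:arxiv-1710.09502 p0004.txt:L42 -/
theorem sComplexity_le_one_of_mem {S : Set V} {g : V} (hg : g ∈ S) : sComplexity S g ≤ 1 :=
  sComplexity_le_of_eq_sum (fun _ : Fin 1 => g) (fun _ => hg) (by simp)

end Subadditive

/-! ## Classes of measures and their barrier constants `c(Δ)` -/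

section Ceiling

variable {V : Type*}

/-- **EGOW 2018, §1.1: barrier constant of a class of measures.** "A barrier result for any such class
of sub-additive measures `Δ ⊆ Δ_S` simply asserts that `μ(f)` is small for every `μ ∈ Δ` and any `f ∈ Ŝ`
(whenever `μ(S)` is small). The quantity `c(Δ) = μ(Ŝ)/μ(S)` upper bounds the best lower bound which can
be proven using any `μ ∈ Δ` … simply as `μ(f) ≤ c(Δ) · μ(S)` for all of them." `MeasureCeiling Δ S T c`
says `c(Δ) ≤ c` on the target set `T` (`T = Ŝ` in the paper): every `μ ∈ Δ` bounded by `r` on `S` is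
bounded by `c · r` on `T` — the tree's `RankMethodCeiling` is the case `Δ = Δ₀^S`
(`measureCeiling_rankMethods_iff`). Measures are `ℕ`-valued here (ranks, dimensions).
[cite: EfremenkoGargOliveiraWigderson2018, §1.1, p. 4] locator: paper:arxiv-1710.09502 p0004.txt:L52 -/
def MeasureCeiling (Δ : Set (V → ℕ)) (S T : Set V) (c : ℕ) : Prop :=
  ∀ μ ∈ Δ, ∀ r : ℕ, (∀ g ∈ S, μ g ≤ r) → ∀ f ∈ T, μ f ≤ c * r

/-- Monotonicity of ceilings: fewer measures, more simple elements, fewer targets, a larger constant.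
[cite: EfremenkoGargOliveiraWigderson2018, §1.1, p. 4] locator: paper:arxiv-1710.09502 p0004.txt:L52 -/
theorem MeasureCeiling.mono {Δ Δ' : Set (V → ℕ)} {S S' T T' : Set V} {c c' : ℕ}
    (h : MeasureCeiling Δ S T c) (hΔ : Δ' ⊆ Δ) (hS : S ⊆ S') (hT : T' ⊆ T) (hc : c ≤ c') :
    MeasureCeiling Δ' S' T' c' :=
  fun μ hμ r hr f hf =>
    (h μ (hΔ hμ) r (fun g hg => hr g (hS hg)) f (hT hf)).trans (Nat.mul_le_mul_right _ hc)

/-- **The barrier read as printed:** under a ceiling `c` for `Δ`, the lower bound `μ(f)/r` that any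
`μ ∈ Δ` certifies for `c_S(f)` (`IsSubadditiveMeasure.div_le_sComplexity`) is at most `c`.
[cite: EfremenkoGargOliveiraWigderson2018, §1.1, p. 4] locator: paper:arxiv-1710.09502 p0004.txt:L55 -/
theorem MeasureCeiling.div_le {Δ : Set (V → ℕ)} {S T : Set V} {c : ℕ} (h : MeasureCeiling Δ S T c)
    {μ : V → ℕ} (hμ : μ ∈ Δ) {r : ℕ} (hr : ∀ g ∈ S, μ g ≤ r) {f : V} (hf : f ∈ T) :
    μ f / r ≤ c :=
  Nat.div_le_of_le_mul (by rw [Nat.mul_comm]; exact h μ hμ r hr f hf)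

variable [AddCommMonoid V]

/-- **`Δ_S` admits no ceiling below the true complexity** ("`c_S` itself is a sub-additive measure in
`Δ_S`, and hence this method can in principle provide tight lower bound on the complexity `c_S(f)`",
p. 4): if the class of ALL sub-additive (`ℕ`-valued) measures has ceiling `c` on `T`, then `c_S ≤ c` on
`T` (in a space where every element decomposes over `S`). [cite: EfremenkoGargOliveiraWigderson2018, §1.1, p. 4] locator: paper:arxiv-1710.09502 p0004.txt:L42 -/
theorem sComplexity_le_of_measureCeiling_subadditive {S T : Set V} {c : ℕ}
    (hS : ∀ f : V, ∃ s : ℕ, ∃ a : Fin s → V, (∀ i, a i ∈ S) ∧ ∑ i, a i = f)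
    (h : MeasureCeiling {μ : V → ℕ | IsSubadditiveMeasure μ} S T c) {f : V} (hf : f ∈ T) :
    sComplexity S f ≤ c := by
  have h1 := h (sComplexity S) (isSubadditiveMeasure_sComplexity hS) 1
    (fun g hg => sComplexity_le_one_of_mem hg) f hf
  rwa [Nat.mul_one] at h1

variable (F : Type*) [Field F] (W : Type*) [AddCommGroup W] [Module F W]

/-- **EGOW 2018, §1.1: the class `Δ₀^S` of rank methods** — the measures `μ_L(f) = rank_F(L(f))` for
linear `L : Ŝ → Mat_m(F)`, any `m` ("We call the elements of `Δ₀^S` as rank methods"; tree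
`rankMeasure`). [cite: EfremenkoGargOliveiraWigderson2018, §1.1, p. 5] locator: paper:arxiv-1710.09502 p0005.txt:L1 -/
def rankMethods : Set (W → ℕ) :=
  {μ | ∃ (m : ℕ) (L : W →ₗ[F] Matrix (Fin m) (Fin m) F), μ = rankMeasure L}

variable {F W}

/-- `μ_L ∈ Δ₀^S`. [cite: EfremenkoGargOliveiraWigderson2018, §1.1, p. 5] locator: paper:arxiv-1710.09502 p0005.txt:L1 -/
theorem rankMeasure_mem_rankMethods {m : ℕ} (L : W →ₗ[F] Matrix (Fin m) (Fin m) F) :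
    rankMeasure L ∈ rankMethods F W :=
  ⟨m, L, rfl⟩

/-- **"Clearly, all these `μ_L ∈ Δ₀^S` are sub-additive measures on `S`"** (p. 5): `Δ₀^S ⊆ Δ_S` (tree
`rankMeasure_add_le`). [cite: EfremenkoGargOliveiraWigderson2018, §1.1, p. 5] locator: paper:arxiv-1710.09502 p0005.txt:L3 -/
theorem rankMethods_subset_subadditive :
    rankMethods F W ⊆ {μ : W → ℕ | IsSubadditiveMeasure μ} := by
  rintro _ ⟨m, L, rfl⟩
  exact fun f g => rankMeasure_add_le L f g

/-- Rank methods vanish at `0`. [cite: EfremenkoGargOliveiraWigderson2018, §1.1, p. 5] locator: paper:arxiv-1710.09502 p0005.txt:L1 -/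
theorem apply_zero_of_mem_rankMethods {μ : W → ℕ} (hμ : μ ∈ rankMethods F W) : μ 0 = 0 := by
  obtain ⟨m, L, rfl⟩ := hμ
  exact rankMeasure_zero L

/-- **`c(Δ₀^S)` is the tree's `RankMethodCeiling`:** a ceiling for the class of rank methods in the
sense of `MeasureCeiling` is exactly `RankMethodCeiling F S T c` (whose restriction to `m > 0` is
immaterial, `RankMethodCeiling.apply`). [cite: EfremenkoGargOliveiraWigderson2018, §1.1, p. 5] locator: paper:arxiv-1710.09502 p0005.txt:L4 -/
theorem measureCeiling_rankMethods_iff {S T : Set W} {c : ℕ} :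
    MeasureCeiling (rankMethods F W) S T c ↔ RankMethodCeiling F S T c := by
  constructor
  · intro h m _ L r hr f hf
    exact h (rankMeasure L) (rankMeasure_mem_rankMethods L) r hr f hf
  · rintro h _ ⟨m, L, rfl⟩ r hr f hf
    exact h.apply L hr hf

/-- A ceiling for all sub-additive measures is in particular a ceiling for rank methods
(`Δ₀^S ⊆ Δ_S`). [cite: EfremenkoGargOliveiraWigderson2018, §1.1, p. 5] locator: paper:arxiv-1710.09502 p0005.txt:L3 -/
theorem rankMethodCeiling_of_measureCeiling_subadditive {S T : Set W} {c : ℕ}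
    (h : MeasureCeiling {μ : W → ℕ | IsSubadditiveMeasure μ} S T c) : RankMethodCeiling F S T c :=
  measureCeiling_rankMethods_iff.1 (h.mono rankMethods_subset_subadditive le_rfl le_rfl le_rfl)

end Ceiling

end Literature.Computability.AlgebraicComplexity
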